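import Mathlib
import Summits.Ventures.HodgeRepro2.T5LocalUnitsProfinite
import Summits.Ventures.HodgeRepro2.T5HaarProbability
import Summits.Ventures.HodgeRepro2.T5KudlaGaussSum
import Summits.Ventures.HodgeRepro2.T5DVRQuotientCard

/-!
# The Haar probability measure of `𝒪[K]` on Mathlib's local-field object; the ideals `(ϖ^n)`

Blind cell `pub-hodge-repro2`, seat p7 (gen 9), Tier-5 kernel support for N5 / §G [R-4]
(route/T5-LEAN-p7.md §22(b)(iv), the DVR / compact-ring / finite-quotient MODELLING clause of the
Gauss-sum chain `T5HaarCosetAverage` → `T5KudlaGaussSum` → `T5EpsilonKudla`).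

The setting is Mathlib's local-field object, as in p4's `T5LocalUnitsProfinite` (p392345): `K` a
complete `NontriviallyNormedField` with `IsUltrametricDist`, `𝒪[K] = Valued.integer K` a discrete
valuation ring with finite residue field `𝓀[K]`; `𝒪[K]` is then COMPACT
(`T5LocalUnitsProfinite.compactSpace_integer`, Mathlib's
`compactSpace_iff_completeSpace_and_isDiscreteValuationRing_and_finite_residueField`).

* `coe_span_pow_eq_closedBall`, `isOpen_span_pow`, `isClosed_span_pow`: the ideal `(ϖ^n)` is the
  closed ball of radius `‖ϖ‖^n`, hence open and closed (ultrametric);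
* `finite_quot_span_pow`, `finiteIndex_span_pow`: `𝒪[K]/(ϖ^n)` is finite of cardinality `q^n`
  (`T5DVRQuotientCard`), `(ϖ^n)` has finite index;
* `haarProb_span_pow`, `haarProb_span_pow_eq_inv_pow`: `vol(𝔭^n) = |𝒪/𝔭^n|⁻¹ = q^{−n}` for the
  Haar probability measure `haarProb 𝒪[K]` (`vol(𝒪_v) = 1`), and `haarProb_coset_one_add`:
  `vol(1 + 𝔭^n) = vol(𝔭^n)`;
* `integral_mulChar_mul_addChar`, `sqrt_card_mul_integral_eq_gNorm`: the Gauss-sum integrals of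
  `T5HaarProbability` (rows 19 / 26) on `𝒪[K]` with `𝔭^c = (ϖ^c)`;
* `kudlaGaussSum_eq_gNorm`, `kudlaGaussSum_mul_kudlaGaussSum_inv`: Kudla's `𝔤` of
  `T5KudlaGaussSum` (row 25) for `μ = haarProb 𝒪[K]` — the `MeasurableSet` / probability /
  invariance / `Fintype` hypotheses of row 25 are all DISCHARGED on the local-field object.

What stays prose: that `F_v` IS such a field (a non-archimedean local field is a complete
nontrivially normed ultrametric field whose integer ring is a DVR with finite residue field — the
reading of print), and the readings of print listed in route/T5-LEAN-p7.md §22(b)(i)–(iii).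
README §8(d): uses an L-value-free non-vanishing device: NO.
-/

namespace Summit.Ventures.HodgeRepro2.T5LocalFieldHaar

open scoped NormedField Valued ENNReal
open Ideal MeasureTheory
open Summit.Ventures.HodgeRepro2

variable {K : Type*} [NontriviallyNormedField K] [IsUltrametricDist K]

section Ideals

variable [IsDiscreteValuationRing 𝒪[K]] {ϖ : 𝒪[K]}

omit [IsDiscreteValuationRing 𝒪[K]] in
/-- The ideal `(ϖ^n)` of `𝒪[K]` is the closed ball of radius `‖ϖ‖^n` about `0`. -/
theorem coe_span_pow_eq_closedBall (n : ℕ) :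
    ((span {ϖ ^ n} : Ideal 𝒪[K]) : Set 𝒪[K]) = Metric.closedBall 0 (‖ϖ‖ ^ n) := by
  rw [Valued.integer.coe_span_singleton_eq_closedBall, norm_pow]

omit [IsDiscreteValuationRing 𝒪[K]] in
/-- `(ϖ^n)` is OPEN in `𝒪[K]` (closed balls of non-zero radius are open in an ultrametric
space). -/
theorem isOpen_span_pow (hϖ : Irreducible ϖ) (n : ℕ) :
    IsOpen ((span {ϖ ^ n} : Ideal 𝒪[K]) : Set 𝒪[K]) := by
  rw [coe_span_pow_eq_closedBall]
  exact IsUltrametricDist.isOpen_closedBall _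
    (pow_ne_zero _ (Valued.integer.norm_irreducible_pos hϖ).ne')

omit [IsDiscreteValuationRing 𝒪[K]] in
/-- `(ϖ^n)` is CLOSED in `𝒪[K]`. -/
theorem isClosed_span_pow (n : ℕ) :
    IsClosed ((span {ϖ ^ n} : Ideal 𝒪[K]) : Set 𝒪[K]) := by
  rw [coe_span_pow_eq_closedBall]
  exact Metric.isClosed_closedBall

omit [IsDiscreteValuationRing 𝒪[K]] in
/-- `(ϖ^n)` is a measurable set for any Borel structure on `𝒪[K]`. -/
theorem measurableSet_span_pow [MeasurableSpace 𝒪[K]] [BorelSpace 𝒪[K]] (n : ℕ) :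
    MeasurableSet ((span {ϖ ^ n} : Ideal 𝒪[K]) : Set 𝒪[K]) :=
  (isClosed_span_pow n).measurableSet

/-- `𝓂[K]^n = (ϖ^n)`. -/
theorem maximalIdeal_pow_eq (hϖ : Irreducible ϖ) (n : ℕ) :
    (𝓂[K] ^ n : Ideal 𝒪[K]) = span {ϖ ^ n} := by
  rw [Valued.maximalIdeal, hϖ.maximalIdeal_eq, span_singleton_pow]

/-- A finite residue field makes `𝒪[K]/(ϖ^n)` finite (`T5DVRQuotientCard`). -/
theorem finite_quot_span_pow [Finite 𝓀[K]] (hϖ : Irreducible ϖ) (n : ℕ) :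
    Finite (𝒪[K] ⧸ span {ϖ ^ n}) :=
  T5DVRQuotientCard.finite_quot_span_pow_of_finite_residueField hϖ n

/-- `|𝒪[K]/(ϖ^n)| = |𝓀[K]|^n`. -/
theorem card_quot_span_pow (hϖ : Irreducible ϖ) (n : ℕ) :
    Nat.card (𝒪[K] ⧸ span {ϖ ^ n}) = Nat.card 𝓀[K] ^ n :=
  T5DVRQuotientCard.card_quot_span_pow_eq_card_residueField_pow hϖ n

/-- `(ϖ^n)` has finite index in `𝒪[K]` (as an additive subgroup). -/
theorem finiteIndex_span_pow [Finite 𝓀[K]] (hϖ : Irreducible ϖ) (n : ℕ) :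
    (span {ϖ ^ n} : Ideal 𝒪[K]).toAddSubgroup.FiniteIndex :=
  haveI := finite_quot_span_pow hϖ n
  haveI : Finite (𝒪[K] ⧸ (span {ϖ ^ n} : Ideal 𝒪[K]).toAddSubgroup) :=
    inferInstanceAs (Finite (𝒪[K] ⧸ span {ϖ ^ n}))
  AddSubgroup.finiteIndex_of_finite_quotient

end Ideals

section Haar

variable [CompleteSpace K] [IsDiscreteValuationRing 𝒪[K]] [Finite 𝓀[K]]
  [MeasurableSpace K] [BorelSpace K] {ϖ : 𝒪[K]}

/-- `𝒪[K]` is compact (p4's `T5LocalUnitsProfinite.compactSpace_integer`, from Mathlib's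
`compactSpace_iff_completeSpace_and_isDiscreteValuationRing_and_finite_residueField`), as an
instance so that `T5HaarProbability.haarProb 𝒪[K]` is available. -/
instance compactSpace_integer : CompactSpace 𝒪[K] :=
  T5LocalUnitsProfinite.compactSpace_integer

/-- The Haar probability measure of the compact ring `𝒪[K]`: Kudla's `vol(𝒪_v) = 1`. -/
noncomputable abbrev haar : Measure 𝒪[K] := T5HaarProbability.haarProb 𝒪[K]

/-- `vol(𝔭^n) = |𝒪[K]/𝔭^n|⁻¹` for the Haar probability measure. -/
theorem haarProb_span_pow (hϖ : Irreducible ϖ) (n : ℕ) :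
    haar (K := K) ((span {ϖ ^ n} : Ideal 𝒪[K]) : Set 𝒪[K]) =
      ((Nat.card (𝒪[K] ⧸ span {ϖ ^ n}) : ℝ≥0∞))⁻¹ := by
  haveI := finite_quot_span_pow hϖ n
  letI : Fintype (𝒪[K] ⧸ span {ϖ ^ n}) := Fintype.ofFinite _
  haveI : Fintype (𝒪[K] ⧸ (span {ϖ ^ n} : Ideal 𝒪[K]).toAddSubgroup) :=
    inferInstanceAs (Fintype (𝒪[K] ⧸ span {ϖ ^ n}))
  have h := T5HaarProbability.haarProb_addSubgroup (span {ϖ ^ n} : Ideal 𝒪[K]).toAddSubgroup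
    (by rw [Submodule.coe_toAddSubgroup]; exact isOpen_span_pow hϖ n)
  rw [Submodule.coe_toAddSubgroup] at h
  rw [h, ← Nat.card_eq_fintype_card]
  rfl

/-- `vol(𝔭^n) = q^{−n}` with `q = |𝓀[K]|`. -/
theorem haarProb_span_pow_eq_inv_pow (hϖ : Irreducible ϖ) (n : ℕ) :
    haar (K := K) ((span {ϖ ^ n} : Ideal 𝒪[K]) : Set 𝒪[K]) =
      ((Nat.card 𝓀[K] : ℝ≥0∞) ^ n)⁻¹ := by
  rw [haarProb_span_pow hϖ n, card_quot_span_pow hϖ n]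
  push_cast
  rfl

/-- The coset `1 + 𝔭^n = {x ∣ x − 1 ∈ 𝔭^n}` has the same Haar measure as `𝔭^n`
(left invariance). -/
theorem haarProb_coset_one_add (n : ℕ) :
    haar (K := K) {x : 𝒪[K] | x - 1 ∈ (span {ϖ ^ n} : Ideal 𝒪[K])} =
      haar (K := K) ((span {ϖ ^ n} : Ideal 𝒪[K]) : Set 𝒪[K]) := by
  have : {x : 𝒪[K] | x - 1 ∈ (span {ϖ ^ n} : Ideal 𝒪[K])} =
      (fun h : 𝒪[K] => (-1 : 𝒪[K]) + h) ⁻¹' ((span {ϖ ^ n} : Ideal 𝒪[K]) : Set 𝒪[K]) := by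
    ext x
    simp [sub_eq_neg_add]
  rw [this, measure_preimage_add]

/-- `vol(1 + 𝔭^n) = q^{−n}`. -/
theorem haarProb_coset_one_add_eq_inv_pow (hϖ : Irreducible ϖ) (n : ℕ) :
    haar (K := K) {x : 𝒪[K] | x - 1 ∈ (span {ϖ ^ n} : Ideal 𝒪[K])} =
      ((Nat.card 𝓀[K] : ℝ≥0∞) ^ n)⁻¹ := by
  rw [haarProb_coset_one_add, haarProb_span_pow_eq_inv_pow hϖ n]

/-- Row 26's Gauss-sum integral on `𝒪[K]`: `∫_{𝒪[K]} χ(ȳ) ψ(ȳ) dy = |𝒪/𝔭^n|⁻¹ · G(χ, ψ)`. -/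
theorem integral_mulChar_mul_addChar (hϖ : Irreducible ϖ) (n : ℕ)
    [Fintype (𝒪[K] ⧸ span {ϖ ^ n})] (χ : MulChar (𝒪[K] ⧸ span {ϖ ^ n}) ℂ)
    (ψ : AddChar (𝒪[K] ⧸ span {ϖ ^ n}) ℂ) :
    ∫ y, χ (Ideal.Quotient.mk (span {ϖ ^ n}) y) * ψ (Ideal.Quotient.mk (span {ϖ ^ n}) y)
        ∂(haar (K := K)) =
      ((Fintype.card (𝒪[K] ⧸ span {ϖ ^ n}) : ℂ))⁻¹ * gaussSum χ ψ :=
  T5HaarProbability.integral_mulChar_mul_addChar_haarProb _ (isOpen_span_pow hϖ n) χ ψ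

/-- Row 26's normalised form on `𝒪[K]`: `√|𝒪/𝔭^n| · ∫ = 𝔤(χ, ψ)` (Kudla's normalisation). -/
theorem sqrt_card_mul_integral_eq_gNorm (hϖ : Irreducible ϖ) (n : ℕ)
    [Fintype (𝒪[K] ⧸ span {ϖ ^ n})] (χ : MulChar (𝒪[K] ⧸ span {ϖ ^ n}) ℂ)
    (ψ : AddChar (𝒪[K] ⧸ span {ϖ ^ n}) ℂ) :
    (Real.sqrt (Fintype.card (𝒪[K] ⧸ span {ϖ ^ n})) : ℂ) *
        ∫ y, χ (Ideal.Quotient.mk (span {ϖ ^ n}) y) * ψ (Ideal.Quotient.mk (span {ϖ ^ n}) y)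
          ∂(haar (K := K)) =
      T5LocalRingGaussSum.gNorm χ ψ :=
  T5HaarProbability.sqrt_card_mul_integral_eq_gNorm_haarProb _ (isOpen_span_pow hϖ n) χ ψ

/-- Kudla's `𝔤(ω, ψ)` (row 25, `T5KudlaGaussSum.kudlaGaussSum`) on the local-field object, for
the Haar probability measure: it is the normalised finite Gauss sum `gNorm` of the descended
characters. -/
theorem kudlaGaussSum_eq_gNorm {m : ℕ} [Fintype (𝒪[K] ⧸ span {ϖ ^ (m + 1)})]
    (hϖ : Irreducible ϖ) (ω' : 𝒪[K]ˣ →* ℂˣ)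
    (h : T5PrincipalUnitFiltration.higherUnits ϖ (m + 1) ≤ ω'.ker) (Ψ : AddChar K ℂ)
    (hΨ : ∀ x : 𝒪[K], Ψ (algebraMap 𝒪[K] K x) = 1) :
    T5KudlaGaussSum.kudlaGaussSum (haar (K := K)) hϖ ω' h Ψ =
      T5LocalRingGaussSum.gNorm (T5CharacterDescent.descendChar hϖ ω' h)
        (T5DVRQuotientModel.shiftChar m hϖ Ψ hΨ) :=
  T5KudlaGaussSum.kudlaGaussSum_eq_gNorm _ (measurableSet_span_pow (m + 1)) hϖ ω' h Ψ hΨ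

/-- The (T1) Gauss-sum identity `𝔤(ω, ψ) 𝔤(ω⁻¹, ψ) = ω(−1)` (row 25) on the local-field object,
every hypothesis on the measure discharged: `ω'` of conductor exactly `𝔭^{m+1}`, `Ψ` trivial on
`𝒪[K]` and non-trivial on `ϖ⁻¹𝒪[K]` (`h₁`, `h₂` are the triviality of `ω'^{±1}` on `1 + 𝔭^{m+1}`,
consequences of `hω`; any proofs of them give the same `𝔤` by proof irrelevance). -/
theorem kudlaGaussSum_mul_kudlaGaussSum_inv {m : ℕ} [Fintype (𝒪[K] ⧸ span {ϖ ^ (m + 1)})]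
    (hϖ : Irreducible ϖ) {ω' : 𝒪[K]ˣ →* ℂˣ}
    (hex : ∃ n, T5PrincipalUnitFiltration.higherUnits ϖ n ≤ ω'.ker)
    (hω : T5ConductorArithmetic.conductor (T5PrincipalUnitFiltration.higherUnits ϖ) ω' = m + 1)
    (h₁ : T5PrincipalUnitFiltration.higherUnits ϖ (m + 1) ≤ ω'.ker)
    (h₂ : T5PrincipalUnitFiltration.higherUnits ϖ (m + 1) ≤ ω'⁻¹.ker)
    (Ψ : AddChar K ℂ) (hΨ : ∀ x : 𝒪[K], Ψ (algebraMap 𝒪[K] K x) = 1) {y : 𝒪[K]}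
    (hy : Ψ (algebraMap 𝒪[K] K y / algebraMap 𝒪[K] K ϖ) ≠ 1) :
    T5KudlaGaussSum.kudlaGaussSum (haar (K := K)) hϖ ω' h₁ Ψ *
        T5KudlaGaussSum.kudlaGaussSum (haar (K := K)) hϖ ω'⁻¹ h₂ Ψ =
      (ω' (-1) : ℂ) :=
  T5KudlaGaussSum.kudlaGaussSum_mul_kudlaGaussSum_inv _ (measurableSet_span_pow (m + 1)) hϖ hex
    hω Ψ hΨ hy

end Haar

/-! ### v2 (append-only): the units `𝒪[K]ˣ` — `vol(𝒪^×) = 1 − q⁻¹` and Kudla's `∫_{𝒪^×}`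

Kudla's `𝔤(ω, ψ)` is displayed as an integral over `𝒪_v^×` (route/T5-CHECK-G-p7.md §4 [R-4];
route/T5-route-3.md §Y.1(b) «vol O^× = 1 − q^{−1}»); rows 19 / 25 integrate over `𝒪` with an
integrand that vanishes off the units.  Here, on the local-field object: the units are the
complement of `(ϖ)`, `vol(𝒪[K]ˣ) = 1 − q⁻¹`, and the two integrals coincide
(`setIntegral_isUnit_eq_integral`, `kudlaGaussSum_eq_sqrt_card_mul_setIntegral`). -/

section Units

variable [CompleteSpace K] [IsDiscreteValuationRing 𝒪[K]] [Finite 𝓀[K]]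
  [MeasurableSpace K] [BorelSpace K] {ϖ : 𝒪[K]}

omit [CompleteSpace K] [Finite 𝓀[K]] [MeasurableSpace K] [BorelSpace K] in
/-- In the DVR `𝒪[K]` the units are the complement of the maximal ideal `(ϖ)`. -/
theorem setOf_isUnit_eq_compl (hϖ : Irreducible ϖ) :
    {x : 𝒪[K] | IsUnit x} = (((span {ϖ} : Ideal 𝒪[K]) : Set 𝒪[K]))ᶜ := by
  ext x
  simp only [Set.mem_setOf_eq, Set.mem_compl_iff, SetLike.mem_coe, mem_span_singleton]
  exact T5DVRQuotientModel.isUnit_iff_not_dvd hϖ x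

omit [CompleteSpace K] [Finite 𝓀[K]] in
/-- The set of units is measurable (it is clopen). -/
theorem measurableSet_setOf_isUnit (hϖ : Irreducible ϖ) :
    MeasurableSet {x : 𝒪[K] | IsUnit x} := by
  rw [setOf_isUnit_eq_compl hϖ]
  have h := measurableSet_span_pow (K := K) (ϖ := ϖ) 1
  rw [pow_one] at h
  exact h.compl

/-- `vol(𝒪[K]ˣ) = 1 − q⁻¹` for the Haar probability measure (`q = |𝓀[K]|`). -/
theorem haarProb_setOf_isUnit (hϖ : Irreducible ϖ) :
    haar (K := K) {x : 𝒪[K] | IsUnit x} = 1 - ((Nat.card 𝓀[K] : ℝ≥0∞))⁻¹ := by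
  have h := measurableSet_span_pow (K := K) (ϖ := ϖ) 1
  have hv := haarProb_span_pow_eq_inv_pow hϖ 1
  rw [pow_one] at h hv
  rw [pow_one] at hv
  rw [setOf_isUnit_eq_compl hϖ, measure_compl h (measure_ne_top _ _), measure_univ, hv]

/-- The Gauss-sum integrand of rows 19 / 26 vanishes off the units: the integral over `𝒪[K]ˣ`
is the integral over `𝒪[K]` (Kudla's `∫_{𝒪^×}`). -/
theorem setIntegral_isUnit_eq_integral {m : ℕ} (hϖ : Irreducible ϖ)
    (χ : MulChar (𝒪[K] ⧸ span {ϖ ^ (m + 1)}) ℂ) (ψ : AddChar (𝒪[K] ⧸ span {ϖ ^ (m + 1)}) ℂ) :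
    ∫ y in {x : 𝒪[K] | IsUnit x},
        χ (Ideal.Quotient.mk (span {ϖ ^ (m + 1)}) y) * ψ (Ideal.Quotient.mk (span {ϖ ^ (m + 1)}) y)
        ∂(haar (K := K)) =
      ∫ y, χ (Ideal.Quotient.mk (span {ϖ ^ (m + 1)}) y) *
        ψ (Ideal.Quotient.mk (span {ϖ ^ (m + 1)}) y) ∂(haar (K := K)) := by
  apply setIntegral_eq_integral_of_forall_compl_eq_zero
  intro y hy
  have hy' : ϖ ∣ y := by
    by_contra hdvd
    exact hy ((T5DVRQuotientModel.isUnit_iff_not_dvd hϖ y).mpr hdvd)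
  rw [MulChar.map_nonunit χ ((T5DVRQuotientModel.isUnit_mk_iff hϖ y).not.mpr (not_not.mpr hy')),
    zero_mul]

/-- Kudla's `𝔤(ω, ψ)` (row 25) on the local-field object AS an integral over the units
`𝒪[K]ˣ`: `𝔤 = √|𝒪/𝔭^{m+1}| · ∫_{𝒪^×} ω'(ȳ) Ψ(y ϖ^{−(m+1)}) dy`. -/
theorem kudlaGaussSum_eq_sqrt_card_mul_setIntegral {m : ℕ}
    [Fintype (𝒪[K] ⧸ span {ϖ ^ (m + 1)})] (hϖ : Irreducible ϖ) (ω' : 𝒪[K]ˣ →* ℂˣ)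
    (h : T5PrincipalUnitFiltration.higherUnits ϖ (m + 1) ≤ ω'.ker) (Ψ : AddChar K ℂ) :
    T5KudlaGaussSum.kudlaGaussSum (haar (K := K)) hϖ ω' h Ψ =
      (Real.sqrt (Fintype.card (𝒪[K] ⧸ span {ϖ ^ (m + 1)})) : ℂ) *
        ∫ y in {x : 𝒪[K] | IsUnit x},
          (T5CharacterDescent.descendChar hϖ ω' h) (Ideal.Quotient.mk (span {ϖ ^ (m + 1)}) y) *
            Ψ (algebraMap 𝒪[K] K y / algebraMap 𝒪[K] K ϖ ^ (m + 1)) ∂(haar (K := K)) := by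
  unfold T5KudlaGaussSum.kudlaGaussSum
  congr 1
  symm
  apply setIntegral_eq_integral_of_forall_compl_eq_zero
  intro y hy
  have hy' : ϖ ∣ y := by
    by_contra hdvd
    exact hy ((T5DVRQuotientModel.isUnit_iff_not_dvd hϖ y).mpr hdvd)
  rw [MulChar.map_nonunit _ ((T5DVRQuotientModel.isUnit_mk_iff hϖ y).not.mpr (not_not.mpr hy')),
    zero_mul]

end Units

end Summit.Ventures.HodgeRepro2.T5LocalFieldHaar
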